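import Mathlib
import Literature.NumberTheory.LFunctions.Zhang2022.Section7ExtendedRangeEq711
import Literature.NumberTheory.LFunctions.Zhang2022.Section7ContourBound
import Literature.NumberTheory.LFunctions.Zhang2022.Section7Eq76Holds
import Literature.NumberTheory.LFunctions.Zhang2022.Section7Eq77Bounds
import HarnessLib

/-!
# Zhang (2022) §7: Proposition 7.1 HOLDS

Topic `Literature/NumberTheory/LFunctions/Zhang2022` (Landau–Siegel audit tree; verdict-neutral).
Y. Zhang, *Discrete mean estimates and the Landau–Siegel zero*, arXiv:2211.02515v1 (2022)
[Zhang2022LandauSiegel] — **an unrefereed manuscript under adjudication**. D-0069 campaign, cell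
`siegel-zhang`.

* `prop71X_holds` — **Proposition 7.1 is a theorem of the tree** (`Skeleton.Prop71 c′`, the first
  of the manuscript's two mean-value propositions, [Z22 §7 p.32, tex L1832–L1855]): the landed
  composition `Section7dStatements.prop71_of_leaves_ab` applied to its three remaining leaves,
  all of which are now theorems — (7.6) `eq76_holds` (p417436 lineage), the `(7.7)′` transition
  `step7t1944_holds` (p419471 lineage), and (7.11) `eq711X'_holds` (p436190, the G-adj2-1
  extended-range chain: the §7 error leg on the FULL (7.2) support). The part-(c) leaf (7.10)
  was already discharged inside `prop71_of_leaves_ab` (`eq710_holds`).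

The proof of Proposition 7.1 as assembled here deviates from the print in exactly the three
places the adjudication recorded and repaired: the (7.13) range (G-adj2-1, extended-range chain
p430402…p436190; the printed `dhr < P₁` restriction remains not derivable as printed), the
(7.14) `|t| > D` tail (G-adj2-2, `deltaW_rapid_decay`), and the (7.19) contour (G-adj2-3,
`contourBoundG0` at `σ = 1 − c₀/𝓛` inside the classical zero-free region).

Theorems only; 0 new definitions; 0 new facts.

WHAT THIS IS NOT: a validation of the printed proof of Proposition 7.1 (three of its steps are
not derivable as printed — the repairs above are load-bearing); any change to `Margin232`
custody (Proposition 2.5/§18 fail exactly as the adjudication of record states, regardless);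
any claim about Theorems 1–2 of the manuscript or about Landau–Siegel zeros.

## References

* Y. Zhang, arXiv:2211.02515v1 (2022), §7 pp. 32–42, tex L1786–L2178.
  [cite: Zhang2022LandauSiegel, §7 pp. 32–42]
-/

noncomputable section

namespace Literature.NumberTheory.LFunctions.Zhang2022.Section7cStatements

open Literature.NumberTheory.LFunctions.Zhang2022

/-- **Proposition 7.1 HOLDS** (`Skeleton.Prop71 c′`, every `c′`): `prop71_of_leaves_ab` at the
theorems `eq76_holds`, `step7t1944_holds`, `eq711X'_holds`. The §7 chain of the manuscript is
thereby kernel-complete, with the three adjudicated repairs (G-adj2-1/2/3) in place of the three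
not-derivable-as-printed steps. [cite: Zhang2022LandauSiegel, §7 Proposition 7.1 p.32,
tex L1832–L1855] -/
theorem prop71X_holds (c' : ℝ) : Skeleton.Prop71 c' :=
  Section7dStatements.prop71_of_leaves_ab c' (Section7bStatements.eq76_holds c')
    (Section7Eq77.step7t1944_holds c') (eq711X'_holds c')

/-- `Skeleton.Prop71` holds for all parameters — `_holds` alias of `prop71X_holds` above (appended
2026-08-28, D-0026 bookkeeping: the proof term is the existing theorem of this file; no
statement, definition or attribute is edited; no new named fact).
[cite: Zhang2022LandauSiegel, §7 Proposition 7.1 p.32, tex L1832–L1855] -/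
theorem _root_.Literature.NumberTheory.LFunctions.Zhang2022.Skeleton.Prop71_holds (c' : ℝ) :
    Skeleton.Prop71 c' :=
  prop71X_holds c'

end Literature.NumberTheory.LFunctions.Zhang2022.Section7cStatements
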